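import Literature.NumberTheory.LFunctions.Zhang2022.RepairDetGluedUnconditional
import Literature.NumberTheory.LFunctions.Zhang2022.RepairDetDiscrete
import Literature.NumberTheory.LFunctions.Zhang2022.RepairIntakeBdet
import Literature.NumberTheory.LFunctions.Zhang2022.RepairIntakeBlen
import Literature.NumberTheory.LFunctions.Zhang2022.RepairIntakeBfam
import Literature.NumberTheory.LFunctions.Zhang2022.KnifeEdgeOverhangRankOne
import Literature.NumberTheory.LFunctions.Zhang2022.RepairBlenLambda
import HarnessLib

/-!
# Zhang (2022), repair class — NAMED MEMBERS of the design structures whose certificates the W1 census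
# (ls-rescue-ref-1 SAT-CENSUS v2, 2026-08-27T12:44:05Z) lists as «UNWITNESSED: design/cover/form-entry structure with
# no named member» — Det.SidesAt, Repair.DetGluedSepDesign.InClass / .VerdictFree, Repair.DetPositiveDesign.InClass,
# and the instance rows of KBdet / KBlen3 / KDiag

Topic `Literature/NumberTheory/LFunctions/Zhang2022` (Landau–Siegel audit tree; verdict-neutral).
Y. Zhang, *Discrete mean estimates and the Landau–Siegel zero*, arXiv:2211.02515v1 (2022) [Zhang2022LandauSiegel] —
**an unrefereed manuscript under adjudication; nothing here asserts or denies any of its claims, and nothing here is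
a claim about Landau–Siegel zeros.**

Director-frontier W1 rule (2026-08-27T11:10:43Z, grammar 11:26:39Z): a conditional certificate `(H₁ ∧ … ∧ Hₙ → C)`
counts upward only with a kind-(a) witness — ONE explicit object meeting all `Hᵢ` at once. The repair class's design
families (`RepairDetGlued`, `RepairDetGluedUnconditional`, `RepairDetDiscrete`, `RepairIntakeBdet/Blen/Bfam`) state
their verdicts `∀ d, InClass d → Verdict d`; this file NAMES one member of each class from the tree's own pieces and
APPLIES every such certificate to it:

* `sidesAt_gStar_zero` — the split `(t₁,t₂) = (1,0)` with side 1 = the kernel mode `g⋆` (`KnifeEdge.inClassPiece_gStar`)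
  and side 2 = `0` (`kinkedProfile_zero`) is a `Det.SidesAt` pair; certificates `SidesAt.add_smul`, `SidesAt.gluedSides`,
  `Det.norm_sq_dictShiftPolar_glued_le` applied (`sidesAt_witness`);
* `detGluedSepWitness` — the no-overlap glued shift-detector design `(b = (1,2,3); (1,0); g⋆ ⊕ 0; g⋆ ⊕ 0)`;
  `detGluedSepWitness_inClass`; certificates `InClass.gluedFormPSD`, `normSq_le_detGluedSep_unconditional`,
  `not_repairable_detGluedSep`, `detGluedSep_unconditional_std` (⇒ `VerdictFree`) and `verdict_of_verdictFree` applied;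
* `detPositiveWitness` — the DET member `shiftDesign ⟨(1,2,3), (−1,1,−1)⟩` with the Cauchy–Schwarz endgame
  (`Det.configValid_cauchySchwarz`); `not_repairable_detPositive` applied;
* the instance rows: `kbdet_w2_std` at `dLeg (1,2,3) θ₀` (`kbdet_inhabited`), `kblen3_nuLip_to_nu` /
  `kblen4_nuLip_variants` at the bump `nuLipBump (5/4)` (`kblen3_nuLip_witnesses`), `vdiag_ac_lt_half` at the
  constant profile on `(0, ½]` (`kdiag_ac_const_half`).

Not witnessed here (said honestly, for the census): the COVER frame `CoverMem` / `Repair.CoverCertified` /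
`FormEntries.{Feeds,Matches*}` (`RepairCoverFrame`, `RepairBarrierAssembly`) — a certificate FRAME whose numeric cover
certificate was never landed (the class verdict is carried by the Cauchy–Schwarz theorem `Repair.not_repairable_true_need`
instead), so those rows stay conditional by design; `EllRegime.EllLambdaPinned` (an (A)-guarded analytic premise, asserted
by no one); `Repair.WallZeroDesign.InClass ∧ BandMeanValue …` (the band-seam estimate E-108 is open). Theorems + three
small defs; no analytic content. «The programme SEARCHES and TYPES; no claim about Landau–Siegel zeros, Theorems 1–2 of
arXiv:2211.02515 or a repaired Margin232 until a kernel theorem says so.»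

## References

* Y. Zhang, arXiv:2211.02515v1 (2022), §2 (2.13)–(2.19), Lemma 2.3, (2.32)–(2.33); §7 Prop 7.1 (7.2); §12 (12.6)–(12.8).
  [cite: Zhang2022LandauSiegel, §§2, 7, 12]
* E. Kowalski, P. Michel, J. VanderKam (2000), Thm 6.1, §8.4. [cite: KowalskiMichelVanderKam2000, Thm 6.1]
-/

noncomputable section

open Real Complex ComplexConjugate Set

namespace Literature.NumberTheory.LFunctions.Zhang2022.Repair

open Det KnifeEdge

/-! ### `Det.SidesAt` and Family B (`DetGluedSepDesign`) -/

/-- **A named `Det.SidesAt` pair on the split `(1, 0)`**: side 1 = the kernel mode `g⋆` with its companion (an in-class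
piece: kinked, vanishing with its companion on `[1, ∞)`), side 2 = `0`. [cite: Zhang2022LandauSiegel, §12 (12.6)–(12.8)] -/
theorem sidesAt_gStar_zero : SidesAt 1 0 gStar gStar' (fun _ => 0) (fun _ => 0) :=
  ⟨inClassPiece_gStar.kinked, kinkedProfile_zero, fun y hy => ⟨inClassPiece_gStar.vanish y hy,
    inClassPiece_gStar.vanish' y hy⟩, fun _ _ => ⟨rfl, rfl⟩⟩

/-- Witness for the `Det.SidesAt` certificates: `SidesAt.add_smul` (the class is closed under the glued combination),
`SidesAt.gluedSides` (no-overlap split ⇒ `GluedSides`), and `Det.norm_sq_dictShiftPolar_glued_le` (Cauchy–Schwarz on the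
glued slot, with `b = (1,2,3)`: `b_j ≠ 0`, `GluedFormPSD` by `gluedFormPSD_of_signAdmissible`) — all at the pair
`g⋆ ⊕ 0` against itself. [cite: Zhang2022LandauSiegel, §12 (12.6)–(12.8); §2 (2.32)–(2.33)] -/
theorem sidesAt_witness :
    SidesAt 1 0 (fun x => gStar x + 1 * gStar x) (fun x => gStar' x + 1 * gStar' x)
      (fun _ => (0 : ℂ) + conj (1 : ℂ) * 0) (fun _ => (0 : ℂ) + conj (1 : ℂ) * 0) ∧
    GluedSides gStar gStar' (fun _ => 0) (fun _ => 0) ∧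
    ‖DictShiftPolar ![1, 2, 3] (gluedProfile gStar (fun _ => 0)) (gluedDeriv gStar' (fun _ => 0))
        (gluedProfile gStar (fun _ => 0)) (gluedDeriv gStar' (fun _ => 0))‖ ^ 2
      ≤ FormDetGlued ![1, 2, 3] gStar gStar' (fun _ => 0) (fun _ => 0) *
        FormDetGlued ![1, 2, 3] gStar gStar' (fun _ => 0) (fun _ => 0) :=
  ⟨sidesAt_gStar_zero.add_smul sidesAt_gStar_zero 1,
    sidesAt_gStar_zero.gluedSides ⟨zero_le_one, le_rfl, by norm_num⟩,
    norm_sq_dictShiftPolar_glued_le signAdmissible_std.ne_zero (gluedFormPSD_of_signAdmissible signAdmissible_std)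
      ⟨zero_le_one, le_rfl, by norm_num⟩ sidesAt_gStar_zero sidesAt_gStar_zero⟩

/-- **A named member of Family B** (`DetGluedSepDesign`): shifts `b = (1,2,3)`, split `(1, 0)`, `H`-side and probe both
`g⋆ ⊕ 0`. [cite: Zhang2022LandauSiegel, §2 (2.13); §12 (12.6)–(12.8)] -/
def detGluedSepWitness : DetGluedSepDesign where
  b := ![1, 2, 3]
  t₁ := 1
  t₂ := 0
  g₁ := gStar
  g₁' := gStar'
  g₂ := fun _ => 0
  g₂' := fun _ => 0
  f₁ := gStar
  f₁' := gStar'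
  f₂ := fun _ => 0
  f₂' := fun _ => 0

/-- `detGluedSepWitness ∈` Family B's class (`SignAdmissible (1,2,3)`, `InShiftBox`, split `0 ≤ 1, 0 ≤ 0, 1 + 0 ≤ 1`,
both side pairs `SidesAt`). [cite: Zhang2022LandauSiegel, §2 (2.13), Lemma 2.3; §12 (12.6)–(12.8)] -/
theorem detGluedSepWitness_inClass : detGluedSepWitness.InClass :=
  ⟨signAdmissible_std, inShiftBox_std, ⟨zero_le_one, le_rfl, by norm_num [detGluedSepWitness]⟩, sidesAt_gStar_zero,
    sidesAt_gStar_zero⟩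

/-- Witness for Family B's certificates at the named member: the glued slot holds (`InClass.gluedFormPSD`), the
Cauchy–Schwarz inequality (`normSq_le_detGluedSep_unconditional`), the displayed-slot verdict
(`not_repairable_detGluedSep`), the slot-free verdict (`detGluedSep_unconditional_std`, `b = (1,2,3)`) and its re-packaging
(`DetGluedSepDesign.verdict_of_verdictFree`). [cite: Zhang2022LandauSiegel, §2 (2.18), (2.32)–(2.33); §18 (18.1)] -/
theorem detGluedSep_witness :
    GluedFormPSD detGluedSepWitness.b ∧ detGluedSepWitness.VerdictFree ∧ detGluedSepWitness.Verdict :=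
  ⟨detGluedSepWitness_inClass.gluedFormPSD,
    detGluedSep_unconditional_std detGluedSepWitness detGluedSepWitness_inClass rfl,
    DetGluedSepDesign.verdict_of_verdictFree detGluedSepWitness
      (detGluedSep_unconditional_std detGluedSepWitness detGluedSepWitness_inClass rfl)⟩

/-- The two remaining Family-B certificates at the named member, stated separately (`normSq_le_…`,
`not_repairable_detGluedSep`). [cite: Zhang2022LandauSiegel, §2 (2.32)–(2.33)] -/
theorem detGluedSep_witness' :
    ‖DictShiftPolar detGluedSepWitness.b (gluedProfile detGluedSepWitness.g₁ detGluedSepWitness.g₂)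
        (gluedDeriv detGluedSepWitness.g₁' detGluedSepWitness.g₂')
        (gluedProfile detGluedSepWitness.f₁ detGluedSepWitness.f₂)
        (gluedDeriv detGluedSepWitness.f₁' detGluedSepWitness.f₂')‖ ^ 2
      ≤ FormDetGlued detGluedSepWitness.b detGluedSepWitness.g₁ detGluedSepWitness.g₁' detGluedSepWitness.g₂
          detGluedSepWitness.g₂' *
        FormDetGlued detGluedSepWitness.b detGluedSepWitness.f₁ detGluedSepWitness.f₁' detGluedSepWitness.f₂
          detGluedSepWitness.f₂' ∧
    detGluedSepWitness.Verdict :=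
  ⟨normSq_le_detGluedSep_unconditional detGluedSepWitness detGluedSepWitness_inClass,
    not_repairable_detGluedSep detGluedSepWitness detGluedSepWitness_inClass⟩

/-! ### Family DET (`DetPositiveDesign`) -/

/-- **A named member of class DET with a configuration-valid endgame**: the shift detector `⟨(1,2,3), (−1,1,−1)⟩`
(`Det.shiftDesign`, shifts in the Part-III box by `inShiftBox_std`), the manuscript's `c′ = 1` slot, two test families,
and the Cauchy–Schwarz endgame `csEndgame 0 1`. [cite: Zhang2022LandauSiegel, §2 (2.13)–(2.19), Lemma 2.3] -/
def detPositiveWitness : DetPositiveDesign where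
  k := 3
  d := shiftDesign ⟨![1, 2, 3], ![-1, 1, -1]⟩ inShiftBox_std
  c' := 1
  r := 2
  Φ := csEndgame 0 1

/-- `detPositiveWitness ∈` class DET (`Det.configValid_cauchySchwarz`) and the DET certificate
`not_repairable_detPositive` applied to it. [cite: Zhang2022LandauSiegel, §2 (2.16)–(2.19), Lemma 2.3] -/
theorem detPositive_witness : detPositiveWitness.InClass ∧ detPositiveWitness.Verdict :=
  have h : detPositiveWitness.InClass := configValid_cauchySchwarz (r := 2) 0 1
  ⟨h, not_repairable_detPositive detPositiveWitness h⟩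

/-! ### The instance rows of `KBdet`, `KBlen3`, `KDiag` -/

/-- Witness for `kbdet_w2_std` (`KBdet (.w2 d)`, `d.b = (1,2,3)`): the `𝔡`-block legs `dLeg (1,2,3) θ₀`
(`kbdet_inhabited`). [cite: Zhang2022LandauSiegel, §2 (2.13), (2.32)–(2.33); §10 (10.1)] -/
theorem kbdet_w2_std_witness :
    KBdet (.stdLegs (dLeg ![1, 2, 3] theta0).u (dLeg ![1, 2, 3] theta0).u' (dLeg ![1, 2, 3] theta0).f
        (dLeg ![1, 2, 3] theta0).f') ∧
      (VBdet (.w2 (dLeg ![1, 2, 3] theta0)) ↔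
        VBdet (.stdLegs (dLeg ![1, 2, 3] theta0).u (dLeg ![1, 2, 3] theta0).u' (dLeg ![1, 2, 3] theta0).f
          (dLeg ![1, 2, 3] theta0).f')) :=
  kbdet_w2_std (dLeg ![1, 2, 3] theta0) kbdet_inhabited.1 rfl

/-- Witness for `kblen3_nuLip_to_nu` and `kblen4_nuLip_variants` (`KBlen3 (.nuLip e)`): the Lipschitz bump at the
knot `5/4` (`kblen3_nuLip_witnesses`). [cite: Zhang2022LandauSiegel, §7 (7.2) p.44] -/
theorem kblen3_nuLip_witness :
    KBlen2 (.nu (nuLipBump (5 / 4)).toNuDesign) ∧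
      (KBlen3 (.nuLip (nuLipBump (5 / 4)).logTwist) ∧ KBlen3 (.nuLip ((nuLipBump (5 / 4)).expTwist 2 1))) :=
  ⟨kblen3_nuLip_to_nu kblen3_nuLip_witnesses.1, kblen4_nuLip_variants kblen3_nuLip_witnesses.1 2 1⟩

/-- **A named member of `K_fam^diag`, `ac` row**: level-individual aspect, `Δ = ½`, constant profile `q ≡ 1`
(`0 < ½ ≤ 1`, `q` and `q²` integrable on `[0,1]`). [cite: KowalskiMichelVanderKam2000, Thm 6.1, §8.4 p. 28] -/
theorem kdiag_ac_const_half : KDiag (.ac .levelIndividual (1 / 2) fun _ => 1) :=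
  ⟨by norm_num, by norm_num, intervalIntegrable_const, by simp⟩

/-- Witness for `vdiag_ac_lt_half` (`KDiag (.ac A Δ q)`, `Δ < 1`): the member `kdiag_ac_const_half`.
[cite: KowalskiMichelVanderKam2000, §8.4 p. 28] -/
theorem vdiag_ac_lt_half_witness : OnePieceMollifierCeiling.propIS (1 / 2) (fun _ => 1) < 1 / 2 :=
  vdiag_ac_lt_half kdiag_ac_const_half (by norm_num)

/-! ### Rev 2 — a NAMED member of the graded Λ-family (`LambdaGradedDesign.InClass`): the kernel mode `g⋆` against the
clipped arch `Λ`-piece of top `2` -/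

/-- The clipped arch profile `y ↦ φ₂(min y 2)` (= `(y−1)(2−y)` on `[1,2]`, `0` below `1` and above `2`), the profile of
the witness Λ-piece. [cite: Zhang2022LandauSiegel, §7 (7.2) p.44] -/
def archPieceProf (y : ℝ) : ℂ := phiT 2 (min y 2)

/-- The witness Λ-piece: order `k = 1`, top `2`, profile `archPieceProf`. [cite: Zhang2022LandauSiegel, §7 (7.2) p.44] -/
def archLambdaPiece : LambdaPiece := ⟨1, 2, archPieceProf⟩

/-- **The clipped arch is an OVERHANG Λ-piece of top `2`** (`KnifeEdge.LambdaPiece.Overhang`): continuous on `[1,2]`,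
right derivative `φ₂′` on `(1,2)` (there `min y 2 = y`), `φ₂′ ∈ L²(1,2]`, zero (with `φ₂′`) below `1`, bounded by `1`.
[cite: Zhang2022LandauSiegel, §7 (7.2) p.44] -/
theorem archLambdaPiece_overhang : archLambdaPiece.Overhang 2 (phiT' 2) where
  order := le_rfl
  top_eq := rfl
  one_lt := by norm_num
  cont := ((continuous_phiT 2).comp (continuous_id.min continuous_const)).continuousOn
  hasDeriv := by
    intro x hx
    have hd := (overhangPiece_phiT (θ := 2) (by norm_num)).hasDeriv x ⟨hx.1.le, hx.2⟩
    refine hd.congr_of_eventuallyEq ?_ (by simp [archLambdaPiece, archPieceProf, min_eq_left hx.2.le])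
    filter_upwards [mem_nhdsWithin_of_mem_nhds (Iio_mem_nhds hx.2)] with y hy
    have hy' : y ≤ 2 := le_of_lt (by simpa using hy)
    simp [archLambdaPiece, archPieceProf, min_eq_left hy']
  memLp := (overhangPiece_phiT (θ := 2) (by norm_num)).memLp
  vanish := fun y hy => by
    simp only [archLambdaPiece, archPieceProf, min_eq_left (by linarith : y ≤ 2)]
    exact phiT_of_le hy.le
  vanish' := fun y hy => phiT'_of_lt hy
  bdd := by
    refine ⟨1, fun z => ?_⟩
    simp only [archLambdaPiece, archPieceProf, phiT, Complex.norm_real, Real.norm_eq_abs]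
    have h1 : 1 ≤ max (min z 2) 1 := le_max_right _ _
    have h2 : max (min z 2) 1 ≤ 2 := max_le (min_le_right _ _) (by norm_num)
    rw [abs_le]
    constructor <;> nlinarith

/-- **A named member of the graded Λ-family**: top `θ = 2`, in-class side `u = g⋆` (kinked, `g⋆(1) = 0`), Λ-piece = the
clipped arch with companion `φ₂′`. [cite: Zhang2022LandauSiegel, §7 (7.2), (2.31)] -/
def lambdaGradedWitness : LambdaGradedDesign := ⟨2, gStar, gStar', archLambdaPiece, phiT' 2⟩

/-- `lambdaGradedWitness ∈` the class, and the three membership projections (`InClass.kinked/.wall/.ovh`, the census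
rows) evaluated at it; the family's KILL-class verdict (`familyLambdaGradedAll_decided`) thereby bites a named member —
it does not make any design «work». [cite: Zhang2022LandauSiegel, §7 Prop 7.1 (7.2), (2.31)] -/
theorem lambdaGradedWitness_inClass :
    lambdaGradedWitness.InClass ∧ KinkedProfile lambdaGradedWitness.u lambdaGradedWitness.u' ∧
      lambdaGradedWitness.u 1 = 0 ∧ lambdaGradedWitness.L.Overhang lambdaGradedWitness.θ lambdaGradedWitness.v' :=
  have h : lambdaGradedWitness.InClass :=
    { kinked := inClassPiece_gStar.kinked
      wall := inClassPiece_gStar.vanish 1 le_rfl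
      ovh := archLambdaPiece_overhang }
  ⟨h, h.kinked, h.wall, h.ovh⟩

/-- The graded family's verdict APPLIED to the named member (non-vacuity of `familyLambdaGradedAll_decided`).
[cite: Zhang2022LandauSiegel, §7 Prop 7.1 (7.2), (2.31)] -/
theorem lambdaGraded_verdict_witness : familyLambdaGradedAll.Verdict lambdaGradedWitness :=
  familyLambdaGradedAll_decided lambdaGradedWitness lambdaGradedWitness_inClass.1

end Literature.NumberTheory.LFunctions.Zhang2022.Repair
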